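import Literature.MathematicalPhysics.QuantumFieldTheory.Balaban1983to89.B9Eq325Pairing
import Literature.MathematicalPhysics.QuantumFieldTheory.Balaban1983to89.B1
import Literature.MathematicalPhysics.QuantumFieldTheory.Balaban1983to89.LatticeNorms

/-!
# `Balaban1983to89.B9Eq324LevelWeights` — B9 p. 394 (3.24) WITH ITS PRINTED LEVEL WEIGHTS: the recursion
# «a_{j+1} = aa_j/(aL⁻² + a_j), a₁ = a₀ = a > 0» AS A DEFINITION WITH BODY (identified with [1] (2.15) = the tree's
# `B1.aSeq` for j ≥ 1), the coefficients a_j(Lʲη)^{d−2}, THE DISPLAY (3.24) level by level on the (3.25) lattice carrier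
# of `B9Thm311Lattice`/`B9Eq325Pairing`, G′ = (Δ′_a)⁻¹ and the (3.25) data FOR THESE WEIGHTS; and p. 393 (3.16)'s
# coefficient a(Lʲη)^{d−2} with the display shape of «⟨A, Q*aQA⟩»

HONEST FRAMING (cell `lit-balaban`, verbatim): statement-level skeleton of published theorems with citation tags; proofs
where landed; nothing here is a claim about the Yang–Mills mass gap.

CITATION HEADER (lean-in-tree rule).  T. Bałaban, *Propagators for lattice gauge theories in a background field*, Commun.
Math. Phys. **99** (1985) 389–434 [`Balaban1985BackgroundPropagators`] (cell paper B9; held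
`paper:balaban1985-cmp99-background-propagators`, journal page = PDF page + 388), p. 393 [PDF 5] (3.16) and p. 394 [PDF 6]
(3.24) with the sentence after it; read by this seat (r06 gen 24, 2026-08-23) on the renders
`b2b-balaban-ref1/pages/1985-cmp99-background-propagators/…-p005-x2.png`, `…-p006-x2.png`.  The recursion is print's pointer
«defined by the same quadratic form as in (2.14)» to [4] = T. Bałaban, *Propagators and renormalization transformations for
lattice gauge theories. II*, Commun. Math. Phys. **96** (1984) 223–250 [`Balaban1984PropagatorsII`] (2.13)–(2.14) p. 225,
whose a_j are «see [1, 2.13 and 2.15]» = T. Bałaban, *(Higgs)₂,₃ quantum fields in a finite volume. I*, Commun. Math. Phys.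
**85** (1982) 603–636 [`Balaban1982Higgs1`] (2.13)/(2.15) p. 609 (the tree's `B1.aSeq`, row B6.Eq2.13 of the cell).  Cell
`lit-balaban`, seat r06 (B9 fold owner), SKELETON rows `B9.Eq3.24` (member with bodies) and `B9.Eq3.16` (located member).

WHAT IS PRINTED («…» verbatim).
* p. 394: «Let us introduce the operator Δ′_a = Δ′_a(U) = (Δ^η_U + Q′*aQ′)↾Ω₀, where Q′*aQ′ is defined by the same quadratic
  form as in (2.14), i.e. ⟨λ, Q′*aQ′λ⟩ = Σ_{j=0}^{k} a_j Σ_{y∈Λ_j} (Lʲη)^{d−2}|(Q′_j(U)λ)(y)|², (3.24) the numbers a_j satisfy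
  the recursive equations a_{j+1} = aa_j/(aL⁻² + a_j), a₁ = a₀ = a > 0. … Its inverse is denoted by G′, or G′(U).»
* p. 393: «We define an operator Q*aQ by the quadratic form ⟨A, Q*aQA⟩ = Σ_{j=0}^{k} a Σ_{b∈Λ_j} (Lʲη)^{d−2}|(Q_j(U)A)(b)|².
  (3.16)»; before it: «Λ_j = Ω_j^{(j)}∖Ω_{j+1}^{(j)}, j = 0, 1, …, k, Ω_{k+1} = ∅», «𝔅 = ⋃_{j=0}^{k} Λ_j» ((3.18)).

WHY THIS FILE.  The row-B9.Eq3.24 objects of the tree type the operator of (3.24) with the LEVEL WEIGHTS AS FREE PARAMETERS: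
`B9Eq325Proj.lapA Δ Q′ Q′* A` (A = «a (level-dependent, an operator on F)»), `B9Thm311Lattice` (`AL a`, a : 𝔅 → ℝ free),
`B9Eq325Pairing.M324 … m κ` (docstring: «block weights κ_y (= a_j (L^jη)^{d−2})», free), `B9Thm37GlueTorusCovTowerDir` (a_j
parameters) — the printed recursion was QUOTED, never given a body, and the coefficient (Lʲη)^{d−2} never formed (owner cell
of row B9.Eq3.24 since gen 1: «defs with body; a_j recursion quoted, level weights as parameters a_j»).  This file supplies
exactly that, on the carrier where the neighbouring rows B9.Eq3.18/3.21/3.23/3.25 are kernel theorems (finite site set X = Ω₀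
with the Dirichlet dictionary of `B9Eq323DirichletSplit`, block set Y = 𝔅, fibre V, transports τ, the (3.19) operator
`qL τ w B Γ y`, Δ^η_U = `lapL`, printed pairings `pairE (η^d)` / `pairF`):
* §1 **`aLevel a L : ℕ → ℝ`** — THE PRINTED RECURSION AS THE BODY (a₀ := a, a₁ := a, a_{j+2} := a·a_{j+1}/(aL⁻² + a_{j+1}));
  `aLevel_succ` (the recursion for every j ≥ 1, by `rfl`), **`aLevel_eq_aSeq`** (IDENTIFICATION: for j ≥ 1 it IS the tree's
  closed form `B1.aSeq a L j = a(1 − L⁻²)/(1 − L^{−2j})` of [1] (2.15), by [1]'s uniqueness theorem `B1.aSeq_unique`),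
  `aLevel_closed`, `aLevel_pos`, `aLevel_le` (a_j ≤ a), `ainf_lt_aLevel` (a(1 − L⁻²) < a_j), `aLevel_succ_le` (a_j ↘), `aLevel_two`.
* §2 **`coeff324 a L η d j := a_j·(Lʲη)^{d−2}`** and **`coeff316 a L η d j := a·(Lʲη)^{d−2}`** (integer exponent d − 2, `Lʲη` =
  `LatticeNorms.scaleLen`), positivity, `coeff324_le_coeff316`; the regrouping `sum_by_levels` (Σ_{y∈𝔅} = Σ_{j=0}^{k} Σ_{y∈Λ_j}).
* §3 **(3.24) ITSELF**: `wt324 … lev` (κ_y := a_{j(y)}(L^{j(y)}η)^{d−2} through the level map y ↦ j, Λ_j = {lev = j}),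
  **`deltaPrimeA`** := `lapL + M324 … (η^d) wt324` («Δ′_a = Δ^η_U + Q′*aQ′»), **`form324`** = THE DISPLAY
  «⟨λ, Q′*aQ′λ⟩ = Σ_{j=0}^{k} a_j Σ_{y∈Λ_j} (Lʲη)^{d−2}|(Q′λ)(y)|²» for the printed fine pairing ⟨λ,λ′⟩ = Σ η^d tr λλ′ (p. 393),
  `deltaPrimeA_eq_lapA` (it IS row B9.Eq3.25's `lapA` at A = diag(κ_y/η^d)), **`exists_Gprime_324`** («Its inverse is denoted
  by G′»: for a > 0, L > 1, η > 0 — hence every κ_y > 0 — Δ′_a > 0, G′ = (Δ′_a)⁻¹ two-sided, C = (Q′G′²Q′*)⁻¹, the (3.25)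
  `Data`, all positive and symmetric: `B9Thm311Lattice.obvious_311_lattice` AT PRINT'S WEIGHTS), **`R325_324_eq_starProjection`**
  (the operator (3.25) built from THESE weights and the printed block pairing Σ_y (L^{j(y)}η)^d⟨·,·⟩ is the orthogonal
  projection onto Δ^η_U N(Q′) of (3.20)–(3.21): `B9Eq325Pairing.R325_weighted_eq_starProjection` AT PRINT'S WEIGHTS) — i.e.
  the place where print consumes (3.24) is served by the rows-3.21/3.25 theorems instantiated, not re-proved.
* §4 (3.16), located member: for ANY linear averaging Q from the fine bond functions to the 𝔅-bond functions (print's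
  «(QA)(b) = (Q_j(U)A)(b), b ∈ Λ_j», [4] (2.20), with Q_j(U) of (3.15) — row B9.Eq3.13's objects, NOT constructed here) the
  operator `qaq316 Q η a L d lev := Q† ∘ diag(a(L^{j(b)}η)^{d−2}/η^d) ∘ Q` and ITS DISPLAY `form316`
  «⟨A, Q*aQA⟩ = Σ_{j=0}^{k} a Σ_{b∈Λ_j} (Lʲη)^{d−2}|(QA)(b)|²» for the bond pairing (3.11) ⟨A,A′⟩ = η^d Σ tr AA′; `M324_eq_opOfForm`.
HONEST SCOPE.  Definitions with bodies + kernel-checked bookkeeping; NO inequality of the paper is asserted; no `Prop` fact.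
(3.24): the block system (B^j(y), L^{−jd}, Γ^{(j)}_{y,x}) and the level map are the carrier's parameters exactly as in rows
B9.Eq3.18–3.25 (print's cubes: rows B9.Def@396, [4] (2.1)–(2.4); `B9Eq318EmbeddedLevels`); unweighted ℓ² model spaces with the
printed weights carried by `pairE`/`pairF`/`M324` (cell divergence D-b09.24, immaterial for (3.25) by `R325_weighted`); «↾Ω₀» =
the carrier X itself (Dirichlet dictionary `B9Eq323DirichletSplit`, row B9.Eq3.23).  (3.16): Q a parameter (see §4).  d − 2 is an
INTEGER exponent (d = 1 allowed formally).  Nothing is inferred from the manuscript beyond the quoted sentences.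
-/

namespace Literature.MathematicalPhysics.QuantumFieldTheory.Balaban1983to89.B9Eq324LevelWeights

open Finset
open B9Thm311Lattice B9Thm311Data B9Eq325Proj B9Eq325Pairing
open Literature.MathematicalPhysics.QuantumFieldTheory.Balaban1983to89.LatticeNorms (scaleLen scaleLen_pos)
open scoped InnerProductSpace

/-! ## §1 (3.24): «a_{j+1} = aa_j/(aL⁻² + a_j), a₁ = a₀ = a» — the recursion as a definition with body -/

section Recursion

/-- **The level constants a_j of (3.24)**, DEFINED BY THE PRINTED RECURSION from the two printed initial values:
a₀ := a, a₁ := a, a_{j+2} := a·a_{j+1}/(a·L⁻² + a_{j+1}) («the numbers a_j satisfy the recursive equations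
a_{j+1} = aa_j/(aL⁻² + a_j), a₁ = a₀ = a > 0»). [cite: Balaban1985BackgroundPropagators, (3.24) p.394 (sentence after the display); Balaban1984PropagatorsII, (2.13) p.225] -/
noncomputable def aLevel (a L : ℝ) : ℕ → ℝ
  | 0 => a
  | 1 => a
  | j + 2 => a * aLevel a L (j + 1) / (a * (L ^ 2)⁻¹ + aLevel a L (j + 1))

/-- «a₀ = a». [cite: Balaban1985BackgroundPropagators, (3.24) p.394] -/
theorem aLevel_zero (a L : ℝ) : aLevel a L 0 = a := rfl

/-- «a₁ = a». [cite: Balaban1985BackgroundPropagators, (3.24) p.394] -/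
theorem aLevel_one (a L : ℝ) : aLevel a L 1 = a := rfl

/-- the second level explicitly: a₂ = a·a/(aL⁻² + a). [cite: Balaban1985BackgroundPropagators, (3.24) p.394] -/
theorem aLevel_two (a L : ℝ) : aLevel a L 2 = a * a / (a * (L ^ 2)⁻¹ + a) := rfl

/-- **«a_{j+1} = aa_j/(aL⁻² + a_j)»** for every j ≥ 1 (the printed recursion IS the defining clause).
[cite: Balaban1985BackgroundPropagators, (3.24) p.394; Balaban1984PropagatorsII, (2.13) p.225] -/
theorem aLevel_succ (a L : ℝ) {j : ℕ} (hj : 1 ≤ j) :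
    aLevel a L (j + 1) = a * aLevel a L j / (a * (L ^ 2)⁻¹ + aLevel a L j) := by
  obtain ⟨i, rfl⟩ := Nat.exists_eq_add_of_le' hj
  rfl

/-- a₂ simplified: a₂ = a/(L⁻² + 1) (a ≠ 0) — strictly below a₁ = a for every L.
[cite: Balaban1985BackgroundPropagators, (3.24) p.394] -/
theorem aLevel_two_eq {a : ℝ} (ha : a ≠ 0) (L : ℝ) : aLevel a L 2 = a / ((L ^ 2)⁻¹ + 1) := by
  rw [aLevel_two]
  have h : a * (L ^ 2)⁻¹ + a = a * ((L ^ 2)⁻¹ + 1) := by ring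
  rw [h, mul_div_mul_left _ _ ha]

/-- **IDENTIFICATION with the tree's [1] (2.15)**: for j ≥ 1 the recursively defined a_j IS the closed form
`B1.aSeq a L j = a(1 − L⁻²)/(1 − L^{−2j})` — by [1]'s printed uniqueness statement `B1.aSeq_unique` («A sequence of numbers
a_k satisfying the above recurrent equation and an initial condition a₁ = a is uniquely determined»).
[cite: Balaban1985BackgroundPropagators, (3.24) p.394; Balaban1982Higgs1, (2.13)–(2.15) p.609] -/
theorem aLevel_eq_aSeq {a L : ℝ} (ha : 0 < a) (hL : 1 < L) {j : ℕ} (hj : 1 ≤ j) : aLevel a L j = B1.aSeq a L j :=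
  B1.aSeq_unique ha hL (aLevel a L) (aLevel_one a L) (fun _ hk => aLevel_succ a L hk) j hj

/-- the closed form of the a_j, j ≥ 1: a_j = a(1 − L⁻²)/(1 − L^{−2j}).
[cite: Balaban1982Higgs1, (2.15) p.609; Balaban1985BackgroundPropagators, (3.24) p.394] -/
theorem aLevel_closed {a L : ℝ} (ha : 0 < a) (hL : 1 < L) {j : ℕ} (hj : 1 ≤ j) :
    aLevel a L j = a * (1 - (L ^ 2)⁻¹) / (1 - ((L ^ 2)⁻¹) ^ j) := by
  rw [aLevel_eq_aSeq ha hL hj, B1.aSeq_eq]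

/-- «a > 0» propagates: every a_j > 0 (a > 0, L > 1). [cite: Balaban1985BackgroundPropagators, (3.24) p.394] -/
theorem aLevel_pos {a L : ℝ} (ha : 0 < a) (hL : 1 < L) (j : ℕ) : 0 < aLevel a L j := by
  rcases Nat.eq_zero_or_pos j with rfl | hj
  · exact ha
  · rw [aLevel_eq_aSeq ha hL hj]
    exact B1.aSeq_pos ha hL hj

/-- a_j ≤ a = a₀ = a₁ for every j. [cite: Balaban1985BackgroundPropagators, (3.24) p.394; Balaban1982Higgs1, (2.15) p.609] -/
theorem aLevel_le {a L : ℝ} (ha : 0 < a) (hL : 1 < L) (j : ℕ) : aLevel a L j ≤ a := by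
  rcases Nat.eq_zero_or_pos j with rfl | hj
  · exact le_rfl
  · rw [aLevel_eq_aSeq ha hL hj]
    exact B1.aSeq_le ha hL j hj

/-- the limit a_∞ = a(1 − L⁻²) is a strict lower bound at every level. [cite: Balaban1982Higgs1, (2.15) p.609; Balaban1985BackgroundPropagators, (3.24) p.394] -/
theorem ainf_lt_aLevel {a L : ℝ} (ha : 0 < a) (hL : 1 < L) (j : ℕ) : a * (1 - (L ^ 2)⁻¹) < aLevel a L j := by
  rcases Nat.eq_zero_or_pos j with rfl | hj
  · rw [aLevel_zero]
    have h : 0 < a * (L ^ 2)⁻¹ := by positivity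
    nlinarith
  · rw [aLevel_eq_aSeq ha hL hj]
    exact B1.ainf_lt_aSeq ha hL j hj

/-- the a_j decrease (weakly from a₀ = a₁, strictly from j = 1 on). [cite: Balaban1982Higgs1, (2.15) p.609; Balaban1985BackgroundPropagators, (3.24) p.394] -/
theorem aLevel_succ_le {a L : ℝ} (ha : 0 < a) (hL : 1 < L) (j : ℕ) : aLevel a L (j + 1) ≤ aLevel a L j := by
  rcases Nat.eq_zero_or_pos j with rfl | hj
  · exact le_rfl
  · rw [aLevel_eq_aSeq ha hL hj, aLevel_eq_aSeq ha hL (Nat.le_succ_of_le hj)]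
    exact (B1.aSeq_succ_lt ha hL hj).le

/-- strict decrease from level 1 on: a_{j+1} < a_j (j ≥ 1). [cite: Balaban1982Higgs1, (2.15) p.609; Balaban1985BackgroundPropagators, (3.24) p.394] -/
theorem aLevel_succ_lt {a L : ℝ} (ha : 0 < a) (hL : 1 < L) {j : ℕ} (hj : 1 ≤ j) : aLevel a L (j + 1) < aLevel a L j := by
  rw [aLevel_eq_aSeq ha hL hj, aLevel_eq_aSeq ha hL (Nat.le_succ_of_le hj)]
  exact B1.aSeq_succ_lt ha hL hj

end Recursion

/-! ## §2 The printed coefficients a_j(Lʲη)^{d−2} of (3.24) and a(Lʲη)^{d−2} of (3.16); regrouping by levels -/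

section Coefficients

/-- **(3.24)'s coefficient of level j: a_j·(Lʲη)^{d−2}** (integer exponent d − 2; `Lʲη` = `LatticeNorms.scaleLen L η j`).
[cite: Balaban1985BackgroundPropagators, (3.24) p.394] -/
noncomputable def coeff324 (a L η : ℝ) (d : ℕ) (j : ℕ) : ℝ := aLevel a L j * scaleLen L η j ^ ((d : ℤ) - 2)

/-- **(3.16)'s coefficient of level j: a·(Lʲη)^{d−2}** (one constant a at every level).
[cite: Balaban1985BackgroundPropagators, (3.16) p.393] -/
noncomputable def coeff316 (a L η : ℝ) (d : ℕ) (j : ℕ) : ℝ := a * scaleLen L η j ^ ((d : ℤ) - 2)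

/-- unfolding. [cite: Balaban1985BackgroundPropagators, (3.24) p.394] -/
theorem coeff324_eq (a L η : ℝ) (d j : ℕ) : coeff324 a L η d j = aLevel a L j * (L ^ j * η) ^ ((d : ℤ) - 2) := rfl

/-- unfolding. [cite: Balaban1985BackgroundPropagators, (3.16) p.393] -/
theorem coeff316_eq (a L η : ℝ) (d j : ℕ) : coeff316 a L η d j = a * (L ^ j * η) ^ ((d : ℤ) - 2) := rfl

/-- level 0: a₀(L⁰η)^{d−2} = a·η^{d−2} (the unaveraged term on Λ₀, «Q′₀λ = λ»). [cite: Balaban1985BackgroundPropagators, (3.24) p.394] -/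
theorem coeff324_zero (a L η : ℝ) (d : ℕ) : coeff324 a L η d 0 = a * η ^ ((d : ℤ) - 2) := by
  rw [coeff324_eq, aLevel_zero, pow_zero, one_mul]

/-- levels 0 and 1 of (3.24) carry the constant a of (3.16): a₀ = a₁ = a. [cite: Balaban1985BackgroundPropagators, (3.16) p.393, (3.24) p.394] -/
theorem coeff324_eq_coeff316_of_le_one (a L η : ℝ) (d : ℕ) {j : ℕ} (hj : j ≤ 1) :
    coeff324 a L η d j = coeff316 a L η d j := by
  interval_cases j <;> rfl

/-- a_j(Lʲη)^{d−2} > 0 (a > 0, L > 1, η > 0). [cite: Balaban1985BackgroundPropagators, (3.24) p.394] -/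
theorem coeff324_pos {a L η : ℝ} (ha : 0 < a) (hL : 1 < L) (hη : 0 < η) (d j : ℕ) : 0 < coeff324 a L η d j :=
  mul_pos (aLevel_pos ha hL j) (zpow_pos (scaleLen_pos (one_pos.trans hL) hη j) _)

/-- a(Lʲη)^{d−2} > 0 (a > 0, L > 0, η > 0). [cite: Balaban1985BackgroundPropagators, (3.16) p.393] -/
theorem coeff316_pos {a L η : ℝ} (ha : 0 < a) (hL : 0 < L) (hη : 0 < η) (d j : ℕ) : 0 < coeff316 a L η d j :=
  mul_pos ha (zpow_pos (scaleLen_pos hL hη j) _)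

/-- a_j(Lʲη)^{d−2} ≤ a(Lʲη)^{d−2} (since a_j ≤ a). [cite: Balaban1985BackgroundPropagators, (3.16) p.393, (3.24) p.394] -/
theorem coeff324_le_coeff316 {a L η : ℝ} (ha : 0 < a) (hL : 1 < L) (hη : 0 < η) (d j : ℕ) :
    coeff324 a L η d j ≤ coeff316 a L η d j :=
  mul_le_mul_of_nonneg_right (aLevel_le ha hL j) (zpow_pos (scaleLen_pos (one_pos.trans hL) hη j) _).le

/-- **«Σ_{j=0}^{k} Σ_{y∈Λ_j}»**: a sum over 𝔅 = ⋃_{j=0}^{k} Λ_j of a level-dependent summand regrouped level by level, Λ_j =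
the fibre {lev = j} of the level map (levels bounded by k; «Ω_{k+1} = ∅»). [cite: Balaban1985BackgroundPropagators, (3.16) p.393, (3.18) p.393, (3.24) p.394] -/
theorem sum_by_levels {Y : Type*} [Fintype Y] (lev : Y → ℕ) {k : ℕ} (hlev : ∀ c, lev c ≤ k) (F : ℕ → Y → ℝ) :
    ∑ c, F (lev c) c = ∑ j ∈ Finset.range (k + 1), ∑ c ∈ univ.filter (fun c => lev c = j), F j c := by
  rw [← Finset.sum_fiberwise_of_maps_to (s := univ) (t := Finset.range (k + 1)) (g := lev)
    (fun c _ => Finset.mem_range.2 (Nat.lt_succ_of_le (hlev c))) (fun c => F (lev c) c)]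
  refine Finset.sum_congr rfl fun j _ => Finset.sum_congr rfl fun c hc => ?_
  rw [(Finset.mem_filter.1 hc).2]

end Coefficients

/-! ## §3 (3.24) on the (3.25) lattice carrier: Δ′_a = Δ^η_U + Q′*aQ′ with print's weights, the display, G′ = (Δ′_a)⁻¹ -/

section Lattice

variable {X Y V : Type*} [NormedAddCommGroup V] [InnerProductSpace ℝ V]

/-- **print's level weights on 𝔅**: κ_y := a_{j}(Lʲη)^{d−2} for y ∈ Λ_j, through the level map y ↦ j(y) (Λ_j = {j(y) = j}).
[cite: Balaban1985BackgroundPropagators, (3.24) p.394, (3.18) p.393] -/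
noncomputable def wt324 (a L η : ℝ) (d : ℕ) (lev : Y → ℕ) : Y → ℝ := fun c => coeff324 a L η d (lev c)

/-- (3.16)'s level weights on the 𝔅-bonds: a(Lʲη)^{d−2} for b ∈ Λ_j. [cite: Balaban1985BackgroundPropagators, (3.16) p.393] -/
noncomputable def wt316 (a L η : ℝ) (d : ℕ) (lev : Y → ℕ) : Y → ℝ := fun c => coeff316 a L η d (lev c)

/-- κ_y > 0. [cite: Balaban1985BackgroundPropagators, (3.24) p.394] -/
theorem wt324_pos {a L η : ℝ} (ha : 0 < a) (hL : 1 < L) (hη : 0 < η) (d : ℕ) (lev : Y → ℕ) (c : Y) :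
    0 < wt324 a L η d lev c :=
  coeff324_pos ha hL hη d (lev c)

/-- a(L^{j(b)}η)^{d−2} > 0. [cite: Balaban1985BackgroundPropagators, (3.16) p.393] -/
theorem wt316_pos {a L η : ℝ} (ha : 0 < a) (hL : 0 < L) (hη : 0 < η) (d : ℕ) (lev : Y → ℕ) (c : Y) :
    0 < wt316 a L η d lev c :=
  coeff316_pos ha hL hη d (lev c)

variable [Fintype X] [Fintype Y] [FiniteDimensional ℝ V]

/-- **The operator of a level-weighted quadratic form of averages** for the fine pairing ⟨·,·⟩_m: Q† ∘ diag(κ/m) ∘ Q — the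
common shape of (3.16) (Q = the bond averaging) and (3.24) (Q = Q′ of (3.19), `M324_eq_opOfForm`).
[cite: Balaban1985BackgroundPropagators, (3.16) p.393, (3.24) p.394] -/
noncomputable def opOfForm (Q : PiLp 2 (fun _ : X => V) →ₗ[ℝ] PiLp 2 (fun _ : Y => V)) (m : ℝ) (κ : Y → ℝ) :
    PiLp 2 (fun _ : X => V) →ₗ[ℝ] PiLp 2 (fun _ : X => V) :=
  LinearMap.adjoint Q ∘ₗ AL (fun c => κ c / m) ∘ₗ Q

/-- the defining identity of `opOfForm`: ⟨f, (Q† diag(κ/m) Q) f⟩_m = Σ_y κ_y ‖(Qf)(y)‖² (m ≠ 0).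
[cite: Balaban1985BackgroundPropagators, (3.16) p.393, (3.24) p.394] -/
theorem pairE_opOfForm_self (Q : PiLp 2 (fun _ : X => V) →ₗ[ℝ] PiLp 2 (fun _ : Y => V)) {m : ℝ} (hm : m ≠ 0)
    (κ : Y → ℝ) (f : PiLp 2 (fun _ : X => V)) :
    pairE m f (opOfForm Q m κ f) = ∑ c, κ c * ‖Q f c‖ ^ 2 := by
  rw [pairE, opOfForm, LinearMap.comp_apply, LinearMap.comp_apply, LinearMap.adjoint_inner_right, AL_div,
    real_inner_smul_right, ← mul_assoc, mul_inv_cancel₀ hm, one_mul, ← pairF, pairF_eq_sum]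
  refine Finset.sum_congr rfl fun c _ => ?_
  rw [real_inner_self_eq_norm_sq]

/-- row B9.Eq3.24's `M324` IS `opOfForm` at Q = Q′ of (3.19). [cite: Balaban1985BackgroundPropagators, (3.24) p.394] -/
theorem M324_eq_opOfForm (τ : X → X → V →ₗ[ℝ] V) (w : Y → X → ℝ) (B : Y → Finset X) (Γ : Y → X → List X) (y : Y → X)
    (m : ℝ) (κ : Y → ℝ) : M324 τ w B Γ y m κ = opOfForm (qL τ w B Γ y) m κ := rfl

variable (τ : X → X → V →ₗ[ℝ] V) (bonds : Finset (X × X)) (cb : X × X → ℝ) (w : Y → X → ℝ) (B : Y → Finset X)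
  (Γ : Y → X → List X) (y : Y → X)

/-- **Δ′_a = Δ′_a(U) := Δ^η_U + Q′*aQ′ of (3.24) WITH THE PRINTED WEIGHTS** κ_y = a_{j(y)}(L^{j(y)}η)^{d−2} and the printed fine
pairing weight η^d (p. 393 «⟨λ, λ′⟩ = Σ η^d tr λ(x)λ′(x)»), on L²(Ω₀, 𝔤) = the carrier of rows B9.Eq3.18–3.25 (X = Ω₀: «↾Ω₀»,
Dirichlet dictionary of row B9.Eq3.23; Y = 𝔅; Q′ = `qL` of (3.19); Δ^η_U = `lapL` of (3.23)).
[cite: Balaban1985BackgroundPropagators, (3.24) p.394, (3.23) p.394, p.393] -/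
noncomputable def deltaPrimeA (η a L : ℝ) (d : ℕ) (lev : Y → ℕ) :
    PiLp 2 (fun _ : X => V) →ₗ[ℝ] PiLp 2 (fun _ : X => V) :=
  lapL τ bonds cb + M324 τ w B Γ y (η ^ d) (wt324 a L η d lev)

/-- Δ′_a IS row B9.Eq3.25's abstract `lapA Δ Q′ Q′* A` at A = diag(κ_y/η^d) (`B9Eq325Pairing.lapL_add_M324`), so every
(3.25)-theorem of `B9Eq325Proj`/`B9Thm311Data`/`B9Thm311Lattice` applies to it by name.
[cite: Balaban1985BackgroundPropagators, (3.24)–(3.25) p.394] -/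
theorem deltaPrimeA_eq_lapA (η a L : ℝ) (d : ℕ) (lev : Y → ℕ) :
    deltaPrimeA τ bonds cb w B Γ y η a L d lev =
      lapA (lapL τ bonds cb) (qL τ w B Γ y) (LinearMap.adjoint (qL τ w B Γ y))
        (AL (fun c => wt324 a L η d lev c / η ^ d)) := rfl

/-- **(3.24), THE DISPLAY**: «⟨λ, Q′*aQ′λ⟩ = Σ_{j=0}^{k} a_j Σ_{y∈Λ_j} (Lʲη)^{d−2}|(Q′_j(U)λ)(y)|²» — for the printed fine pairing
⟨·,·⟩ = η^d Σ tr(·,·) (η ≠ 0), with (Q′λ)(y) = (Q′_{j(y)}(U)λ)(y) the (3.18)/(3.19) operator of the carrier and Λ_j = {j(y) = j},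
all levels ≤ k. [cite: Balaban1985BackgroundPropagators, (3.24) p.394, (3.18) p.393] -/
theorem form324 {η : ℝ} (hη : η ≠ 0) (a L : ℝ) (d : ℕ) {lev : Y → ℕ} {k : ℕ} (hlev : ∀ c, lev c ≤ k)
    (f : PiLp 2 (fun _ : X => V)) :
    pairE (η ^ d) f (M324 τ w B Γ y (η ^ d) (wt324 a L η d lev) f) =
      ∑ j ∈ Finset.range (k + 1), aLevel a L j *
        ∑ c ∈ univ.filter (fun c => lev c = j), scaleLen L η j ^ ((d : ℤ) - 2) * ‖qL τ w B Γ y f c‖ ^ 2 := by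
  rw [pairE_M324_self τ w B Γ y (pow_ne_zero d hη) _ f]
  have key := sum_by_levels lev hlev
    (fun j c => aLevel a L j * (scaleLen L η j ^ ((d : ℤ) - 2) * ‖qL τ w B Γ y f c‖ ^ 2))
  beta_reduce at key
  simp only [wt324, coeff324, mul_assoc]
  rw [key]
  refine Finset.sum_congr rfl fun j _ => ?_
  rw [Finset.mul_sum]

/-- (3.24) as the quadratic form of the whole operator: ⟨λ, Δ′_aλ⟩ = ⟨λ, Δ^η_Uλ⟩ + Σ_j a_j Σ_{y∈Λ_j}(Lʲη)^{d−2}|(Q′λ)(y)|²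
(first term = ‖D^η_Uλ‖² by row B9.Eq3.23's `inner_lapL_self`). [cite: Balaban1985BackgroundPropagators, (3.22)–(3.24) p.394] -/
theorem pairE_deltaPrimeA {η : ℝ} (hη : η ≠ 0) (a L : ℝ) (d : ℕ) {lev : Y → ℕ} {k : ℕ} (hlev : ∀ c, lev c ≤ k)
    (f : PiLp 2 (fun _ : X => V)) :
    pairE (η ^ d) f (deltaPrimeA τ bonds cb w B Γ y η a L d lev f) =
      pairE (η ^ d) f (lapL τ bonds cb f) +
        ∑ j ∈ Finset.range (k + 1), aLevel a L j *
          ∑ c ∈ univ.filter (fun c => lev c = j), scaleLen L η j ^ ((d : ℤ) - 2) * ‖qL τ w B Γ y f c‖ ^ 2 := by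
  rw [← form324 τ w B Γ y hη a L d hlev f, deltaPrimeA, LinearMap.add_apply, pairE, pairE, pairE, inner_add_right,
    mul_add]

/-- **«Its inverse is denoted by G′, or G′(U)»** — FOR PRINT'S WEIGHTS (a > 0, L > 1, η > 0, hence every κ_y > 0): on every
finite lattice block system with injective transports and positive bond weights, Δ′_a is positive definite, G′ = (Δ′_a)⁻¹
exists as a TWO-SIDED inverse, C = (Q′G′²Q′*)⁻¹ exists, (G′, C) are the (3.25) `Data`, and G′, C are positive definite and
symmetric — row B9.Eq3.25's `B9Thm311Lattice.obvious_311_lattice` (Theorem 3.11 «obvious for the first three operators»)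
INSTANTIATED at the weights of this file, not re-proved. [cite: Balaban1985BackgroundPropagators, (3.24)–(3.25) p.394, Thm 3.11 p.416] -/
theorem exists_Gprime_324 (hinj : ∀ x x' : X, Function.Injective (τ x x')) (hcb : ∀ b ∈ bonds, 0 < cb b)
    (hS : IsBlockSystem bonds w B Γ y) {η a L : ℝ} (hη : 0 < η) (ha : 0 < a) (hL : 1 < L) (d : ℕ) (lev : Y → ℕ) :
    ∃ (g : PiLp 2 (fun _ : X => V) →ₗ[ℝ] PiLp 2 (fun _ : X => V))
      (c : PiLp 2 (fun _ : Y => V) →ₗ[ℝ] PiLp 2 (fun _ : Y => V)),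
      Data (lapL τ bonds cb) (qL τ w B Γ y) (LinearMap.adjoint (qL τ w B Γ y))
          (AL (fun c => wt324 a L η d lev c / η ^ d)) g c ∧
        PosDef (deltaPrimeA τ bonds cb w B Γ y η a L d lev) ∧ PosDef g ∧ PosDef c ∧
        (∀ f f', ⟪g f, f'⟫_ℝ = ⟪f, g f'⟫_ℝ) ∧ (∀ φ ψ, ⟪c φ, ψ⟫_ℝ = ⟪φ, c ψ⟫_ℝ) ∧
        (∀ f, g (deltaPrimeA τ bonds cb w B Γ y η a L d lev f) = f) ∧
        ∀ f, deltaPrimeA τ bonds cb w B Γ y η a L d lev (g f) = f := by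
  obtain ⟨g, c, hd, hpos, hg, hc, hgs, hcs⟩ := obvious_311_lattice τ hinj cb hcb hS
    (fun c => wt324 a L η d lev c / η ^ d) (fun c => div_pos (wt324_pos ha hL hη d lev c) (pow_pos hη d))
  exact ⟨g, c, hd, hpos, hg, hc, hgs, hcs, hd.g_left, hd.g_right⟩

/-- **(3.25) AT PRINT'S WEIGHTS**: with the fine pairing η^d⟨·,·⟩, the block pairing Σ_y (L^{j(y)}η)^d⟨·,·⟩ and the (3.24) weights
κ_y = a_{j(y)}(L^{j(y)}η)^{d−2}, the operators G′_w = (Δ′_a)⁻¹, C_w = (Q′G′_w²Q′*_w)⁻¹ exist (two-sided) and the operator (3.25)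
R = I − G′Q′*(Q′G′²Q′*)⁻¹Q′G′ built from them IS the orthogonal projection onto Δ^η_U N(Q′) of (3.20)–(3.21) — row B9.Eq3.25's
`B9Eq325Pairing.R325_weighted_eq_starProjection` INSTANTIATED (the place where print consumes (3.24)).
[cite: Balaban1985BackgroundPropagators, (3.20)–(3.21), (3.24)–(3.25) p.394] -/
theorem R325_324_eq_starProjection (hinj : ∀ x x' : X, Function.Injective (τ x x')) (hcb : ∀ b ∈ bonds, 0 < cb b)
    (hS : IsBlockSystem bonds w B Γ y) {η a L : ℝ} (hη : 0 < η) (ha : 0 < a) (hL : 1 < L) (d : ℕ) (lev : Y → ℕ) :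
    ∃ (g' : PiLp 2 (fun _ : X => V) →ₗ[ℝ] PiLp 2 (fun _ : X => V))
      (c' : PiLp 2 (fun _ : Y => V) →ₗ[ℝ] PiLp 2 (fun _ : Y => V)),
      (∀ f, g' (deltaPrimeA τ bonds cb w B Γ y η a L d lev f) = f) ∧
        (∀ f, deltaPrimeA τ bonds cb w B Γ y η a L d lev (g' f) = f) ∧
        (∀ φ, c' (qL τ w B Γ y (g' (g' (qsW τ w B Γ y (η ^ d) (fun c => scaleLen L η (lev c) ^ d) φ)))) = φ) ∧
        (∀ φ, qL τ w B Γ y (g' (g' (qsW τ w B Γ y (η ^ d) (fun c => scaleLen L η (lev c) ^ d) (c' φ)))) = φ) ∧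
        ∀ f, R325 (qL τ w B Γ y) (qsW τ w B Γ y (η ^ d) (fun c => scaleLen L η (lev c) ^ d)) g' c' f =
          (lapKer (lapL τ bonds cb) (qL τ w B Γ y)).starProjection f :=
  R325_weighted_eq_starProjection τ hinj cb hcb hS (pow_pos hη d) (fun c => scaleLen L η (lev c) ^ d)
    (wt324 a L η d lev) (fun c => pow_pos (scaleLen_pos (one_pos.trans hL) hη (lev c)) d) (wt324_pos ha hL hη d lev)

end Lattice

/-! ## §4 (3.16), located member: the coefficient a(Lʲη)^{d−2} and the display shape for a parameter bond averaging Q -/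

section Bonds

variable {X Y V : Type*} [NormedAddCommGroup V] [InnerProductSpace ℝ V] [Fintype X] [Fintype Y] [FiniteDimensional ℝ V]

/-- **the operator Q*aQ of (3.16) for a PARAMETER averaging Q** (print: «(QA)(b) = (Q_j(U)A)(b)» for b ∈ Λ_j, [4] (2.20), with the
bond averagings Q_j(U) = Q(Ū^{j−1})⋯Q(U) of (3.15) — row B9.Eq3.13's objects, NOT constructed in this file): Q† ∘ diag(a(L^{j(b)}η)^{d−2}/η^d) ∘ Q
on the bond functions A ∈ L²(Ω₀-bonds, 𝔤) (X = the fine bonds, Y = the 𝔅-bonds, fine pairing (3.11) ⟨A,A′⟩ = η^d Σ tr AA′).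
[cite: Balaban1985BackgroundPropagators, (3.16) p.393, (3.15) p.393, (3.11) p.392] -/
noncomputable def qaq316 (Q : PiLp 2 (fun _ : X => V) →ₗ[ℝ] PiLp 2 (fun _ : Y => V)) (η a L : ℝ) (d : ℕ) (lev : Y → ℕ) :
    PiLp 2 (fun _ : X => V) →ₗ[ℝ] PiLp 2 (fun _ : X => V) :=
  opOfForm Q (η ^ d) (wt316 a L η d lev)

/-- **(3.16), THE DISPLAY SHAPE**: «⟨A, Q*aQA⟩ = Σ_{j=0}^{k} a Σ_{b∈Λ_j} (Lʲη)^{d−2}|(Q_j(U)A)(b)|²» for the parameter averaging Q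
((QA)(b) = (Q_{j(b)}(U)A)(b)), the fine pairing η^d⟨·,·⟩ (η ≠ 0), Λ_j = {j(b) = j}, all levels ≤ k.
[cite: Balaban1985BackgroundPropagators, (3.16) p.393] -/
theorem form316 (Q : PiLp 2 (fun _ : X => V) →ₗ[ℝ] PiLp 2 (fun _ : Y => V)) {η : ℝ} (hη : η ≠ 0) (a L : ℝ) (d : ℕ)
    {lev : Y → ℕ} {k : ℕ} (hlev : ∀ c, lev c ≤ k) (A : PiLp 2 (fun _ : X => V)) :
    pairE (η ^ d) A (qaq316 Q η a L d lev A) =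
      ∑ j ∈ Finset.range (k + 1), a *
        ∑ b ∈ univ.filter (fun b => lev b = j), scaleLen L η j ^ ((d : ℤ) - 2) * ‖Q A b‖ ^ 2 := by
  rw [qaq316, pairE_opOfForm_self Q (pow_ne_zero d hη) _ A]
  have key := sum_by_levels lev hlev (fun j b => a * (scaleLen L η j ^ ((d : ℤ) - 2) * ‖Q A b‖ ^ 2))
  beta_reduce at key
  simp only [wt316, coeff316, mul_assoc]
  rw [key]
  refine Finset.sum_congr rfl fun j _ => ?_
  rw [Finset.mul_sum]

/-- the (3.16) form dominates the (3.24)-weighted form of the same averages termwise (a_j ≤ a): for any Q,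
⟨f, Q†diag(κ₃₂₄/η^d)Qf⟩ ≤ ⟨f, Q†diag(κ₃₁₆/η^d)Qf⟩ (η > 0). [cite: Balaban1985BackgroundPropagators, (3.16) p.393, (3.24) p.394] -/
theorem pairE_opOfForm_324_le_316 (Q : PiLp 2 (fun _ : X => V) →ₗ[ℝ] PiLp 2 (fun _ : Y => V)) {η a L : ℝ} (hη : 0 < η)
    (ha : 0 < a) (hL : 1 < L) (d : ℕ) (lev : Y → ℕ) (f : PiLp 2 (fun _ : X => V)) :
    pairE (η ^ d) f (opOfForm Q (η ^ d) (wt324 a L η d lev) f) ≤ pairE (η ^ d) f (opOfForm Q (η ^ d) (wt316 a L η d lev) f) := by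
  rw [pairE_opOfForm_self Q (pow_ne_zero d hη.ne') _ f, pairE_opOfForm_self Q (pow_ne_zero d hη.ne') _ f]
  exact Finset.sum_le_sum fun c _ =>
    mul_le_mul_of_nonneg_right (coeff324_le_coeff316 ha hL hη d (lev c)) (sq_nonneg _)

end Bonds

end Literature.MathematicalPhysics.QuantumFieldTheory.Balaban1983to89.B9Eq324LevelWeights
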